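/-
Copyright (c) 2026 the pub-hodgecm-mathlib formalisation cell (harness21).  Prover seat hodgecm-mathlib-LH4-p14 (g8) (L1 valve hand; K1b∕ρ desk K2Liu-p14 (g4),
2026-09-05T00:05:27Z «(ρ4-𝔸) → LH4-p14»), Track B «K2-LIT» ∕ hLiu418 #184♮, socket #41 KIND 1, package (K1b-♮), letter (P-dec) ∕ (dec-3) exponential face:
(ρ4-𝔸) THE CORNER GRAM BOUND AT THE ARCHIMEDEAN PLACES — ★ (ρ4) p863056's matrix core read under every complex embedding of the CM field.  THEOREMS ONLY.
-/
import Summits.HodgeConjecture.HodgeConjecture.Theorems.K2LiuKindOneLineCornerGramBound       -- ★ p863056 (ρ4) core: `cornerIndex_entry_le_of_levi_coord`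
import Summits.HodgeConjecture.HodgeConjecture.Theorems.K2LiuRankOneCornerIndexTransport       -- ★ p862643: the rational letters (Levi relation, corner law) — vocabulary only
import Mathlib.NumberTheory.NumberField.CMField                                                -- `NumberField.IsCMField.complexEmbedding_complexConj`
import Mathlib.NumberTheory.NumberField.CanonicalEmbedding.Basic                               -- `mixedEmbedding`, `normAtPlace`, `norm_eq_sup'_normAtPlace`
import HarnessLib

/-!
# Crux `HLiu418`, socket #41, KIND 1 — (P-dec) ∕ (dec-3), letter (ρ4-𝔸) `K2LiuKindOneLineCornerGramBoundAdelic`: THE CORNER GRAM BOUND AT THE ARCHIMEDEAN PLACES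

Cell `hodgecm-mathlib`, crux item hLiu418 = `stmt-HodgeConjecture-24832` (helper lane `--supports … --as helper`, count-neutral), route of record `HCCMUnconditional`;
squad K2 ∕ K2Liu, road `K2_Liu`, socket #41, KIND 1, package (K1b-♮), letter (P-dec) = (dec-1) ★ p863428 ∘ (dec-3) (desk K2Liu-p14 (g4)) ∘ (dec-2) (by value).
FRAME OF RECORD (desk 2026-09-05T00:05:27Z): the `InfinitePlace L` ∕ `NumberField.mixedEmbedding L` currency of ★ (KW1-d) §2 and of the TOP's size
`τb S = ‖fun i j => mixedEmbedding L (↑S i j)‖` — NOT the tube frame.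
THE MATHEMATICS [MoeglinWaldspurger1995, II.1.5, II.1.7], [BorelJacquet1979, §1.2, §4.1], [Shimura1997, §18.4, §A3].  ★ (ρ4) p863056 is pure matrix algebra over `ℂ`:
from the Levi relation `ĝᴴ · diag T · D₀ = diag T`, the corner law `D₀ · S = σ♭ · E_{i₀i₀} · ĝ` and an Iwasawa Levi block `A` (`A A′ = 1`, `|A′_{kl}| ≤ M`) it bounds every entry
`‖S_{ij}‖ ≤ C_T · (n M²) · (‖σ♭‖ · a²)` as soon as `Σ_k ‖(ĝ_{i₀•} A)_k‖² ≤ a²`.  THIS FILE reads it at the archimedean places of the CM field `L`: a complex embedding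
`φ : L →+* ℂ` commutes with complex conjugation (Mathlib `IsCMField.complexEmbedding_complexConj`), so the RATIONAL letters of ★ p862643 — the Levi relation
`c(ĝ)ᵀ · T_L · D₀ = T_L` of `exists_rat_levi_blocks_levi_map` and the corner law `D₀ · S · ĝ⁻¹ = σ♭ E₁₁` of `conj_index_eq_single` — map to ★ (ρ4)'s hypotheses over `ℂ`
(`T_L` is diagonal with non-zero entries: `dV, dW ≠ 0`), with ONE constant `C_T` depending on the hermitian data only (uniform over the finitely many embeddings):
* §1 `exists_gramRL_eq_diagonal` (`T_L = diag t`, `t_i ≠ 0`), `exists_CT` (one `C_T ≥ 1` with `‖φ(t₁)‖ · ‖φ(t_i)⁻¹‖ ≤ C_T` for all `φ, i`), and the transport lemmas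
  `conjTranspose_map_eq` (`(ĝ.map φ)ᴴ = (c(ĝ)ᵀ).map φ`), `levi_relation_map`, `corner_law_map`.
* §2 **`exists_cornerGramBound_embedding`** — `∃ C_T > 0, ∀ φ ĝ D₀ S σ♭ (letters) A A′ M a (letters) i j, ‖φ (S i j)‖ ≤ C_T · (2 M²) · (‖φ σ♭‖ · a²)`.
* §3 the `mixedEmbedding` ∕ height currency: **`exists_norm_mixedEmbedding_le_sum`** — with one mover bound `M` for all places and per-place Levi coordinates `a w`,
  `‖fun i j => mixedEmbedding L (S i j)‖ ≤ C_T · (2 M²) · Σ_w w(σ♭) · (a w)²`; and the EXPONENTIAL FACE in the TOP's shape **`exists_exp_neg_sum_le_exp_neg_height`** —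
  `∃ c > 0` (hermitian data and the mover constant `C_B` only) with `exp(−π · Σ_w w(σ♭) · (a w)²) ≤ exp(−(c · H^{−2} · ‖fun i j => mixedEmbedding L (S i j)‖))` whenever
  `1 ≤ M ≤ C_B · H` (★ G7-B `block_entry_bounds`' currency: `M ~ H(h_∞)`), i.e. the `hdecb` exponent with `a′ = 2` — the row section `ĝ` and the block `D₀` have CANCELLED.
* §4 (ED. 2): **`exists_norm_mixedEmbedding_le_sum_of_cover`**, **`exists_exp_neg_sum_le_exp_neg_height_of_cover`** — the same two letters indexed by a COVER
  `w : ι → InfinitePlace L` (surjective) of the infinite places, as the ★ G7 frames of record index them (`σ : Sinf`).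
* §5 (ED. 3): **`exists_exp_neg_sum_le_exp_neg_height_of_cover_rate`** — the exponential face at a PAYER-CHOSEN rate `cπ > 0` (repair (R2) of the block letter's
  mover class: `c = cπ ∕ (C_T · n · C_B²)`).
HONEST LABEL.  Count-neutral helper, by value in the rational letters (★ p862643) and in the Iwasawa letters `(A, A′, M, a)` (★ G7-B ∕ (e∞) on the consumer's side); closes no
socket: `HC_CM` is proved only modulo the 7 printed citations (2 remaining named inputs: hLiu418 = `stmt-HodgeConjecture-24832`, h413 = `stmt-HodgeConjecture-24833`) until
rung 0 closes.

## References
* [MoeglinWaldspurger1995] C. Mœglin, J.-L. Waldspurger, *Spectral decomposition and Eisenstein series* (1995): II.1.5, II.1.7.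
* [BorelJacquet1979] A. Borel, H. Jacquet, Corvallis I (1979): §1.2, §4.1 (Iwasawa decomposition, heights).
* [Shimura1997] G. Shimura, CBMS 93 (1997): §18.4, §A3.
-/

set_option autoImplicit false
-- the mandated namespace repeats the single-problem summit's segment (`HodgeConjecture.HodgeConjecture`)
set_option linter.dupNamespace false

noncomputable section

open scoped Matrix ComplexConjugate BigOperators
-- `Classical` is needed to see the Mathlib normed-ring instances on `mixedSpace L` (as in the TOP's `hτ`)
open scoped Classical
open Matrix NumberField NumberField.InfinitePlace NumberField.mixedEmbedding
open Literature.NumberTheory.GelbartRogawski1991 Literature.NumberTheory.GelbartRogawski1991.GRConstruction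
open Literature.NumberTheory.GelbartRogawski1991.UnitaryDualPair (realDiagonal)

namespace Summit.HodgeConjecture.HodgeConjecture.Cruxes.HLiu418.K2LiuKindOneLineCornerGramBoundAdelic

open K2LiuKindOneLineCornerGramBound (cornerIndex_entry_le_of_levi_coord)

variable (L : Type) [Field L] [NumberField L] [IsCMField L]
variable {N M n : ℕ} (e : Fin N × Fin M ≃ Fin n)
  (dV : Fin N → L) (hdV : ∀ i, IsCMField.complexConj L (dV i) = dV i)
  (dW : Fin M → L) (hdW : ∀ i, IsCMField.complexConj L (dW i) = dW i)

/-! ## §1 The hermitian form is diagonal with non-zero entries; one constant for all embeddings; transport of the rational letters -/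

/-- `T_L = gramR ⊗ L` is a diagonal matrix `diag t` with `t_i ≠ 0` (★ `gramR_eq_diagonal`; `dV, dW ≠ 0`). [cite: GelbartRogawski1991, §3.1 Prop. 3.1.1] -/
theorem exists_gramRL_eq_diagonal (hdV0 : ∀ i, dV i ≠ 0) (hdW0 : ∀ i, dW i ≠ 0) :
    ∃ t : Fin n → L, (gramR L e dV hdV dW hdW).map (algebraMap (Fp L) L) = Matrix.diagonal t ∧ ∀ i, t i ≠ 0 := by
  -- `gramR = reindex e e (diag dV ⊗ diag dW)` is diagonal over `L⁺` (as in ★ `exists_corner_supported_levi`)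
  set t₀ : Fin n → Fp L := (fun mn : Fin N × Fin M =>
    (⟨dV mn.1, (IsCMField.complexConj_eq_self_iff (K := L) (dV mn.1)).1 (hdV mn.1)⟩ : Fp L) *
      (⟨dW mn.2, (IsCMField.complexConj_eq_self_iff (K := L) (dW mn.2)).1 (hdW mn.2)⟩ : Fp L)) ∘ e.symm with ht₀
  have hex : gramR L e dV hdV dW hdW = Matrix.diagonal t₀ := by
    unfold gramR Literature.NumberTheory.GelbartRogawski1991.UnitaryDualPair.gram realDiagonal
    rw [Matrix.diagonal_kronecker_diagonal, Matrix.reindex_apply, Matrix.submatrix_diagonal_equiv]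
  refine ⟨fun i => algebraMap (Fp L) L (t₀ i), by rw [hex, Matrix.diagonal_map (map_zero _)], fun i => ?_⟩
  rw [map_ne_zero]
  simp only [ht₀, Function.comp_apply]
  exact mul_ne_zero (fun h => hdV0 _ (congrArg Subtype.val h)) (fun h => hdW0 _ (congrArg Subtype.val h))

omit [IsCMField L] in
/-- **ONE CONSTANT FOR ALL EMBEDDINGS**: for `t : Fin n → L` with `t_i ≠ 0` and a distinguished index `i₀` there is `C_T ≥ 1` with `‖φ (t i₀)‖ · ‖(φ (t i))⁻¹‖ ≤ C_T` for every
complex embedding `φ` and every `i` (finitely many embeddings: take the sum). [folklore] -/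
theorem exists_CT {t : Fin n → L} (i₀ : Fin n) :
    ∃ CT : ℝ, 1 ≤ CT ∧ ∀ (φ : L →+* ℂ) (i : Fin n), ‖φ (t i₀)‖ * ‖(φ (t i))⁻¹‖ ≤ CT := by
  refine ⟨1 + ∑ φ : L →+* ℂ, ∑ i : Fin n, ‖φ (t i₀)‖ * ‖(φ (t i))⁻¹‖, le_add_of_nonneg_right (Finset.sum_nonneg fun _ _ =>
    Finset.sum_nonneg fun _ _ => mul_nonneg (norm_nonneg _) (norm_nonneg _)), fun φ i => ?_⟩
  have h1 : ‖φ (t i₀)‖ * ‖(φ (t i))⁻¹‖ ≤ ∑ j : Fin n, ‖φ (t i₀)‖ * ‖(φ (t j))⁻¹‖ :=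
    Finset.single_le_sum (f := fun j => ‖φ (t i₀)‖ * ‖(φ (t j))⁻¹‖) (fun _ _ => mul_nonneg (norm_nonneg _) (norm_nonneg _)) (Finset.mem_univ i)
  have h2 : ∑ j : Fin n, ‖φ (t i₀)‖ * ‖(φ (t j))⁻¹‖ ≤ ∑ ψ : L →+* ℂ, ∑ j : Fin n, ‖ψ (t i₀)‖ * ‖(ψ (t j))⁻¹‖ :=
    Finset.single_le_sum (f := fun ψ : L →+* ℂ => ∑ j : Fin n, ‖ψ (t i₀)‖ * ‖(ψ (t j))⁻¹‖)
      (fun _ _ => Finset.sum_nonneg fun _ _ => mul_nonneg (norm_nonneg _) (norm_nonneg _)) (Finset.mem_univ φ)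
  linarith

/-- transport of the conjugate transpose: `(ĝ.map φ)ᴴ = (c(ĝ)ᵀ).map φ` — a complex embedding of a CM field commutes with complex conjugation (Mathlib
`IsCMField.complexEmbedding_complexConj`). [folklore] -/
theorem conjTranspose_map_eq (φ : L →+* ℂ) (g : Matrix (Fin n) (Fin n) L) :
    (g.map φ)ᴴ = ((g.map ((IsCMField.complexConj L : L ≃ₐ[Fp L] L) : L →+* L))ᵀ).map φ := by
  ext i j
  simp only [conjTranspose_apply, map_apply, transpose_apply, RingHom.coe_coe, Complex.star_def]
  exact (IsCMField.complexEmbedding_complexConj L φ (g j i)).symm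

/-- transport of the LEVI RELATION: `c(ĝ)ᵀ · diag t · D₀ = diag t` over `L` ⇒ `(ĝ.map φ)ᴴ · diag (φ ∘ t) · D₀.map φ = diag (φ ∘ t)` over `ℂ`. [cite: MoeglinWaldspurger1995, II.1.7] -/
theorem levi_relation_map (φ : L →+* ℂ) {t : Fin n → L} {g D₀ : Matrix (Fin n) (Fin n) L}
    (hrel : (g.map ((IsCMField.complexConj L : L ≃ₐ[Fp L] L) : L →+* L))ᵀ * Matrix.diagonal t * D₀ = Matrix.diagonal t) :
    (g.map φ)ᴴ * Matrix.diagonal (fun i => φ (t i)) * D₀.map φ = Matrix.diagonal (fun i => φ (t i)) := by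
  have h := congrArg (fun X : Matrix (Fin n) (Fin n) L => X.map φ) hrel
  simp only [Matrix.map_mul, Matrix.diagonal_map (map_zero φ)] at h
  rw [conjTranspose_map_eq]
  exact h

omit [NumberField L] [IsCMField L] in
/-- transport of the CORNER LAW: `D₀ · S · ĝ⁻¹ = σ♭ E_{i₀i₀}` over `L` (`ĝ` invertible) ⇒ `D₀.map φ · S.map φ = φ(σ♭) · (E_{i₀i₀} · ĝ.map φ)` over `ℂ`. [cite: Shimura1997, §18.4] -/
theorem corner_law_map (φ : L →+* ℂ) {g D₀ S : Matrix (Fin n) (Fin n) L} (hg : IsUnit g.det) {σ : L} (i₀ : Fin n)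
    (hcorner : D₀ * S * g⁻¹ = Matrix.single i₀ i₀ σ) :
    D₀.map φ * S.map φ = φ σ • (Matrix.single i₀ i₀ (1 : ℂ) * g.map φ) := by
  have h1 : D₀ * S = Matrix.single i₀ i₀ σ * g := by
    calc D₀ * S = D₀ * S * g⁻¹ * g := by rw [Matrix.nonsing_inv_mul_cancel_right _ _ hg]
      _ = Matrix.single i₀ i₀ σ * g := by rw [hcorner]
  have h := congrArg (fun X : Matrix (Fin n) (Fin n) L => X.map φ) h1
  simp only [Matrix.map_mul] at h
  have hsingle : (Matrix.single i₀ i₀ σ).map φ = φ σ • Matrix.single i₀ i₀ (1 : ℂ) := by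
    ext i j
    simp only [map_apply, Matrix.smul_apply, smul_eq_mul, Matrix.single_apply]
    split_ifs <;> simp
  rw [h, hsingle, Matrix.smul_mul]

/-! ## §2 (ρ4) under every complex embedding -/

/-- **(ρ4-𝔸) THE CORNER GRAM BOUND UNDER EVERY COMPLEX EMBEDDING.**  Hermitian data `dV, dW ≠ 0` (so `T_L = diag t`, `t_i ≠ 0`).  THEN `∃ C_T > 0` such that for every
complex embedding `φ`, every `ĝ ∈ GL_n(L)` with a block `D₀` satisfying the Levi relation `c(ĝ)ᵀ T_L D₀ = T_L` (★ p862643 `exists_rat_levi_blocks_levi_map`), every index `S`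
with the corner law `D₀ S ĝ⁻¹ = σ♭ E_{i₀i₀}` (★ `conj_index_eq_single`, `i₀ = 1` at `n = 2`), every Iwasawa Levi block `A` at `φ` with `A A′ = 1`, `|A′_{kl}| ≤ M`, and every
`a` with `Σ_k ‖((φ ∘ ĝ_{i₀•}) ᵥ* A)_k‖² ≤ a²`:  `‖φ (S i j)‖ ≤ C_T · (n M²) · (‖φ σ♭‖ · a²)` for all `i j`.
[cite: MoeglinWaldspurger1995, II.1.5, II.1.7] [cite: BorelJacquet1979, §1.2, §4.1] [cite: Shimura1997, §18.4, §A3] -/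
theorem exists_cornerGramBound_embedding (hdV0 : ∀ i, dV i ≠ 0) (hdW0 : ∀ i, dW i ≠ 0) (i₀ : Fin n) :
    ∃ CT : ℝ, 0 < CT ∧ ∀ (φ : L →+* ℂ) (g : GL (Fin n) L) (D₀ : Matrix (Fin n) (Fin n) L),
      ((g : Matrix (Fin n) (Fin n) L).map ((IsCMField.complexConj L : L ≃ₐ[Fp L] L) : L →+* L))ᵀ * (gramR L e dV hdV dW hdW).map (algebraMap (Fp L) L) * D₀ =
          (gramR L e dV hdV dW hdW).map (algebraMap (Fp L) L) →
      ∀ (S : Matrix (Fin n) (Fin n) L) (σ : L), D₀ * S * (g : Matrix (Fin n) (Fin n) L)⁻¹ = Matrix.single i₀ i₀ σ →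
      ∀ {A A' : Matrix (Fin n) (Fin n) ℂ}, A * A' = 1 → ∀ {M : ℝ}, (∀ k l, ‖A' k l‖ ≤ M) →
      ∀ {a : ℝ}, ∑ k, ‖((fun l => φ ((g : Matrix (Fin n) (Fin n) L) i₀ l)) ᵥ* A) k‖ ^ 2 ≤ a ^ 2 →
      ∀ i j, ‖φ (S i j)‖ ≤ CT * (n * M ^ 2) * (‖φ σ‖ * a ^ 2) := by
  obtain ⟨t, hT, ht0⟩ := exists_gramRL_eq_diagonal L e dV hdV dW hdW hdV0 hdW0
  obtain ⟨CT, hCT1, hCT⟩ := exists_CT (L := L) (t := t) i₀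
  refine ⟨CT, lt_of_lt_of_le one_pos hCT1, fun φ g D₀ hrel S σ hcorner A A' hA M hM a ha i j => ?_⟩
  rw [hT] at hrel
  have hLevi := levi_relation_map L φ hrel
  have hS := corner_law_map L φ (Matrix.isUnits_det_units g) i₀ hcorner
  have hφt : ∀ i, φ (t i) ≠ 0 := fun i => (map_ne_zero φ).2 (ht0 i)
  have key := cornerIndex_entry_le_of_levi_coord (fun i => φ (t i)) hφt ((g : Matrix (Fin n) (Fin n) L).map φ) (D₀.map φ) (S.map φ) (φ σ) i₀
    hLevi hS hA hM (fun i => hCT φ i) (a := a) (by simpa only [map_apply] using ha) i j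
  simpa only [map_apply] using key

/-! ## §3 The `mixedEmbedding` currency and the exponential face in the TOP's shape -/

section Mixed

variable {L}

omit [IsCMField L] in
/-- the sup norm of the mixed embedding of a matrix is attained placewise: `‖fun i j => mixedEmbedding L (S i j)‖ ≤ B` as soon as `w (S i j) ≤ B` for all `w i j` (`0 ≤ B`).
[folklore] -/
theorem norm_mixedEmbedding_matrix_le {m : ℕ} (S : Matrix (Fin m) (Fin m) L) {B : ℝ} (hB : 0 ≤ B)
    (h : ∀ (w : InfinitePlace L) (i j : Fin m), w (S i j) ≤ B) :
    ‖fun i j => mixedEmbedding L (S i j)‖ ≤ B := by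
  refine (pi_norm_le_iff_of_nonneg hB).2 fun i => (pi_norm_le_iff_of_nonneg hB).2 fun j => ?_
  rw [norm_eq_sup'_normAtPlace]
  exact Finset.sup'_le _ _ fun w _ => by rw [normAtPlace_apply]; exact h w i j

omit [NumberField L] [IsCMField L] in
/-- every infinite place of `L` is `‖φ ·‖` for its embedding `φ = w.embedding`. [folklore] -/
theorem place_apply_eq_norm_embedding (w : InfinitePlace L) (x : L) : w x = ‖w.embedding x‖ :=
  (norm_embedding_eq w x).symm

end Mixed

/-- **(ρ4-𝔸) IN THE `mixedEmbedding` CURRENCY.**  With ONE mover bound `M` for all places and per-place Levi coordinates `a w` (the letters of §2 at `φ = w.embedding` for every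
infinite place `w`): `‖fun i j => mixedEmbedding L (S i j)‖ ≤ C_T · (n M²) · Σ_w w(σ♭) · (a w)²`. [cite: MoeglinWaldspurger1995, II.1.5, II.1.7] [cite: Shimura1997, §A3] -/
theorem exists_norm_mixedEmbedding_le_sum (hdV0 : ∀ i, dV i ≠ 0) (hdW0 : ∀ i, dW i ≠ 0) (i₀ : Fin n) :
    ∃ CT : ℝ, 0 < CT ∧ ∀ (g : GL (Fin n) L) (D₀ : Matrix (Fin n) (Fin n) L),
      ((g : Matrix (Fin n) (Fin n) L).map ((IsCMField.complexConj L : L ≃ₐ[Fp L] L) : L →+* L))ᵀ * (gramR L e dV hdV dW hdW).map (algebraMap (Fp L) L) * D₀ =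
          (gramR L e dV hdV dW hdW).map (algebraMap (Fp L) L) →
      ∀ (S : Matrix (Fin n) (Fin n) L) (σ : L), D₀ * S * (g : Matrix (Fin n) (Fin n) L)⁻¹ = Matrix.single i₀ i₀ σ →
      ∀ (A A' : InfinitePlace L → Matrix (Fin n) (Fin n) ℂ), (∀ w, A w * A' w = 1) → ∀ {M : ℝ}, (∀ w k l, ‖A' w k l‖ ≤ M) →
      ∀ (a : InfinitePlace L → ℝ), (∀ w, ∑ k, ‖((fun l => (w.embedding) ((g : Matrix (Fin n) (Fin n) L) i₀ l)) ᵥ* A w) k‖ ^ 2 ≤ a w ^ 2) →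
      ‖fun i j => mixedEmbedding L (S i j)‖ ≤ CT * (n * M ^ 2) * ∑ w : InfinitePlace L, w σ * a w ^ 2 := by
  obtain ⟨CT, hCT, hb⟩ := exists_cornerGramBound_embedding L e dV hdV dW hdW hdV0 hdW0 i₀
  refine ⟨CT, hCT, fun g D₀ hrel S σ hcorner A A' hA M hM a ha => ?_⟩
  have hsum0 : ∀ w : InfinitePlace L, 0 ≤ w σ * a w ^ 2 := fun w => mul_nonneg (apply_nonneg w σ) (sq_nonneg _)
  have hK0 : 0 ≤ CT * (n * M ^ 2) := mul_nonneg hCT.le (mul_nonneg (Nat.cast_nonneg _) (sq_nonneg _))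
  refine norm_mixedEmbedding_matrix_le S (mul_nonneg hK0 (Finset.sum_nonneg fun w _ => hsum0 w)) fun w i j => ?_
  have hw := hb w.embedding g D₀ hrel S σ hcorner (hA w) (hM w) (ha w) i j
  rw [norm_embedding_eq, norm_embedding_eq] at hw
  exact hw.trans (mul_le_mul_of_nonneg_left
    (Finset.single_le_sum (f := fun w : InfinitePlace L => w σ * a w ^ 2) (fun w _ => hsum0 w) (Finset.mem_univ w)) hK0)

/-- **THE EXPONENTIAL FACE OF `hdecb` (`a′ = 2`), THE ROW SECTION AND `D₀` CANCELLED.**  Hermitian data and a mover constant `C_B > 0` fixed: `∃ c > 0` such that for the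
letters of `exists_norm_mixedEmbedding_le_sum` with `1 ≤ M ≤ C_B · H` (★ G7-B `block_entry_bounds`: the inverse Iwasawa Levi block of `h_∞` has entries `≤ M`, `M ~ H(h)`):
`exp(−π · Σ_w w(σ♭) · (a w)²) ≤ exp(−(c · H^{−2} · ‖fun i j => mixedEmbedding L (S i j)‖))` — ★ (KW1-d) §2's Gaussian input against the TOP's size `τb S`.
[cite: MoeglinWaldspurger1995, II.1.5, II.1.7] [cite: BorelJacquet1979, §1.2, §4.1] [cite: Shimura1997, §18.4 Prop. 18.14, §A3] -/
theorem exists_exp_neg_sum_le_exp_neg_height (hdV0 : ∀ i, dV i ≠ 0) (hdW0 : ∀ i, dW i ≠ 0) (i₀ : Fin n) [NeZero n] {CB : ℝ} (hCB : 0 < CB) :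
    ∃ c : ℝ, 0 < c ∧ ∀ (g : GL (Fin n) L) (D₀ : Matrix (Fin n) (Fin n) L),
      ((g : Matrix (Fin n) (Fin n) L).map ((IsCMField.complexConj L : L ≃ₐ[Fp L] L) : L →+* L))ᵀ * (gramR L e dV hdV dW hdW).map (algebraMap (Fp L) L) * D₀ =
          (gramR L e dV hdV dW hdW).map (algebraMap (Fp L) L) →
      ∀ (S : Matrix (Fin n) (Fin n) L) (σ : L), D₀ * S * (g : Matrix (Fin n) (Fin n) L)⁻¹ = Matrix.single i₀ i₀ σ →
      ∀ (A A' : InfinitePlace L → Matrix (Fin n) (Fin n) ℂ), (∀ w, A w * A' w = 1) → ∀ {M : ℝ}, (∀ w k l, ‖A' w k l‖ ≤ M) →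
      ∀ (a : InfinitePlace L → ℝ), (∀ w, ∑ k, ‖((fun l => (w.embedding) ((g : Matrix (Fin n) (Fin n) L) i₀ l)) ᵥ* A w) k‖ ^ 2 ≤ a w ^ 2) →
      ∀ {H : ℝ}, 0 < H → 1 ≤ M → M ≤ CB * H →
      Real.exp (-(Real.pi * ∑ w : InfinitePlace L, w σ * a w ^ 2)) ≤
        Real.exp (-(c * H ^ (-(2 : ℝ)) * ‖fun i j => mixedEmbedding L (S i j)‖)) := by
  obtain ⟨CT, hCT, hb⟩ := exists_norm_mixedEmbedding_le_sum L e dV hdV dW hdW hdV0 hdW0 i₀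
  have hn : 0 < (n : ℝ) := Nat.cast_pos.2 (Nat.pos_of_ne_zero (NeZero.ne n))
  -- `c := π ∕ (C_T · n · C_B²)`
  refine ⟨Real.pi / (CT * n * CB ^ 2), div_pos Real.pi_pos (mul_pos (mul_pos hCT hn) (pow_pos hCB 2)),
    fun g D₀ hrel S σ hcorner A A' hA M hM a ha H hH hM1 hMH => ?_⟩
  have hτ := hb g D₀ hrel S σ hcorner A A' hA hM a ha
  set τ : ℝ := ‖fun i j => mixedEmbedding L (S i j)‖ with hτdef
  set sa : ℝ := ∑ w : InfinitePlace L, w σ * a w ^ 2 with hsa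
  have hM0 : 0 < M := lt_of_lt_of_le one_pos hM1
  -- `τ ≤ C_T n M² Σ ≤ C_T n C_B² H² Σ`, so `c H⁻² τ ≤ π Σ`
  have hM2 : M ^ 2 ≤ CB ^ 2 * H ^ 2 := by
    rw [← mul_pow]; exact pow_le_pow_left₀ hM0.le hMH 2
  have hsa0 : 0 ≤ sa := Finset.sum_nonneg fun w _ => mul_nonneg (apply_nonneg w σ) (sq_nonneg _)
  have h1 : τ ≤ CT * (n * (CB ^ 2 * H ^ 2)) * sa :=
    hτ.trans (mul_le_mul_of_nonneg_right (mul_le_mul_of_nonneg_left (mul_le_mul_of_nonneg_left hM2 hn.le) hCT.le) hsa0)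
  have hH2 : H ^ (-(2 : ℝ)) = (H ^ 2)⁻¹ := by
    rw [Real.rpow_neg hH.le, Real.rpow_two]
  have hkey : Real.pi / (CT * n * CB ^ 2) * H ^ (-(2 : ℝ)) * τ ≤ Real.pi * sa := by
    rw [hH2]
    have hpos : 0 < CT * n * CB ^ 2 * H ^ 2 := by positivity
    calc Real.pi / (CT * n * CB ^ 2) * (H ^ 2)⁻¹ * τ = Real.pi * τ / (CT * n * CB ^ 2 * H ^ 2) := by
          field_simp
      _ ≤ Real.pi * (CT * (n * (CB ^ 2 * H ^ 2)) * sa) / (CT * n * CB ^ 2 * H ^ 2) :=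
          div_le_div_of_nonneg_right (mul_le_mul_of_nonneg_left h1 Real.pi_pos.le) hpos.le
      _ = Real.pi * sa := by field_simp
  exact Real.exp_le_exp.2 (neg_le_neg hkey)

/-! ## §4 Edition 2 (append-only): the same letters indexed by a COVER of the infinite places (the ★ G7 frames' `σ : Sinf`, `w σ`) -/

/-- **(ρ4-𝔸) IN THE `mixedEmbedding` CURRENCY, COVER-INDEXED.**  As `exists_norm_mixedEmbedding_le_sum`, but the per-place Iwasawa letters are indexed by an arbitrary finite
type `ι` through a SURJECTION `w : ι → InfinitePlace L` (the ★ G7 frames of record index the complex places of the CM field by `σ : Sinf`, `w σ`, with a covering letter):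
`‖fun i j => mixedEmbedding L (S i j)‖ ≤ C_T · (n M²) · Σ_σ (w σ)(σ♭) · (a σ)²`. [cite: MoeglinWaldspurger1995, II.1.5, II.1.7] [cite: Shimura1997, §A3] -/
theorem exists_norm_mixedEmbedding_le_sum_of_cover (hdV0 : ∀ i, dV i ≠ 0) (hdW0 : ∀ i, dW i ≠ 0) (i₀ : Fin n) :
    ∃ CT : ℝ, 0 < CT ∧ ∀ {ι : Type*} [Fintype ι] (w : ι → InfinitePlace L), Function.Surjective w →
      ∀ (g : GL (Fin n) L) (D₀ : Matrix (Fin n) (Fin n) L),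
      ((g : Matrix (Fin n) (Fin n) L).map ((IsCMField.complexConj L : L ≃ₐ[Fp L] L) : L →+* L))ᵀ * (gramR L e dV hdV dW hdW).map (algebraMap (Fp L) L) * D₀ =
          (gramR L e dV hdV dW hdW).map (algebraMap (Fp L) L) →
      ∀ (S : Matrix (Fin n) (Fin n) L) (σf : L), D₀ * S * (g : Matrix (Fin n) (Fin n) L)⁻¹ = Matrix.single i₀ i₀ σf →
      ∀ (A A' : ι → Matrix (Fin n) (Fin n) ℂ), (∀ σ, A σ * A' σ = 1) → ∀ {M : ℝ}, (∀ σ k l, ‖A' σ k l‖ ≤ M) →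
      ∀ (a : ι → ℝ), (∀ σ, ∑ k, ‖((fun l => ((w σ).embedding) ((g : Matrix (Fin n) (Fin n) L) i₀ l)) ᵥ* A σ) k‖ ^ 2 ≤ a σ ^ 2) →
      ‖fun i j => mixedEmbedding L (S i j)‖ ≤ CT * (n * M ^ 2) * ∑ σ, (w σ) σf * a σ ^ 2 := by
  obtain ⟨CT, hCT, hb⟩ := exists_cornerGramBound_embedding L e dV hdV dW hdW hdV0 hdW0 i₀
  refine ⟨CT, hCT, fun {ι} _ w hw g D₀ hrel S σf hcorner A A' hA M hM a ha => ?_⟩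
  have hsum0 : ∀ σ : ι, 0 ≤ (w σ) σf * a σ ^ 2 := fun σ => mul_nonneg (apply_nonneg _ σf) (sq_nonneg _)
  have hK0 : 0 ≤ CT * (n * M ^ 2) := mul_nonneg hCT.le (mul_nonneg (Nat.cast_nonneg _) (sq_nonneg _))
  refine norm_mixedEmbedding_matrix_le S (mul_nonneg hK0 (Finset.sum_nonneg fun σ _ => hsum0 σ)) fun v i j => ?_
  obtain ⟨σ, rfl⟩ := hw v
  have hσ := hb (w σ).embedding g D₀ hrel S σf hcorner (hA σ) (hM σ) (ha σ) i j
  rw [norm_embedding_eq, norm_embedding_eq] at hσ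
  exact hσ.trans (mul_le_mul_of_nonneg_left
    (Finset.single_le_sum (f := fun σ : ι => (w σ) σf * a σ ^ 2) (fun σ _ => hsum0 σ) (Finset.mem_univ σ)) hK0)

/-- **THE EXPONENTIAL FACE, COVER-INDEXED**: `∃ c > 0` (hermitian data, `C_B`) such that for the cover-indexed letters with `1 ≤ M ≤ C_B · H`:
`exp(−π · Σ_σ (w σ)(σ♭) · (a σ)²) ≤ exp(−(c · H^{−2} · ‖fun i j => mixedEmbedding L (S i j)‖))` — the ★ G7 frames' indexing of ★ (KW1-d) §2.
[cite: MoeglinWaldspurger1995, II.1.5, II.1.7] [cite: BorelJacquet1979, §1.2, §4.1] [cite: Shimura1997, §18.4 Prop. 18.14, §A3] -/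
theorem exists_exp_neg_sum_le_exp_neg_height_of_cover (hdV0 : ∀ i, dV i ≠ 0) (hdW0 : ∀ i, dW i ≠ 0) (i₀ : Fin n) [NeZero n] {CB : ℝ} (hCB : 0 < CB) :
    ∃ c : ℝ, 0 < c ∧ ∀ {ι : Type*} [Fintype ι] (w : ι → InfinitePlace L), Function.Surjective w →
      ∀ (g : GL (Fin n) L) (D₀ : Matrix (Fin n) (Fin n) L),
      ((g : Matrix (Fin n) (Fin n) L).map ((IsCMField.complexConj L : L ≃ₐ[Fp L] L) : L →+* L))ᵀ * (gramR L e dV hdV dW hdW).map (algebraMap (Fp L) L) * D₀ =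
          (gramR L e dV hdV dW hdW).map (algebraMap (Fp L) L) →
      ∀ (S : Matrix (Fin n) (Fin n) L) (σf : L), D₀ * S * (g : Matrix (Fin n) (Fin n) L)⁻¹ = Matrix.single i₀ i₀ σf →
      ∀ (A A' : ι → Matrix (Fin n) (Fin n) ℂ), (∀ σ, A σ * A' σ = 1) → ∀ {M : ℝ}, (∀ σ k l, ‖A' σ k l‖ ≤ M) →
      ∀ (a : ι → ℝ), (∀ σ, ∑ k, ‖((fun l => ((w σ).embedding) ((g : Matrix (Fin n) (Fin n) L) i₀ l)) ᵥ* A σ) k‖ ^ 2 ≤ a σ ^ 2) →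
      ∀ {H : ℝ}, 0 < H → 1 ≤ M → M ≤ CB * H →
      Real.exp (-(Real.pi * ∑ σ, (w σ) σf * a σ ^ 2)) ≤
        Real.exp (-(c * H ^ (-(2 : ℝ)) * ‖fun i j => mixedEmbedding L (S i j)‖)) := by
  obtain ⟨CT, hCT, hb⟩ := exists_norm_mixedEmbedding_le_sum_of_cover L e dV hdV dW hdW hdV0 hdW0 i₀
  have hn : 0 < (n : ℝ) := Nat.cast_pos.2 (Nat.pos_of_ne_zero (NeZero.ne n))
  refine ⟨Real.pi / (CT * n * CB ^ 2), div_pos Real.pi_pos (mul_pos (mul_pos hCT hn) (pow_pos hCB 2)),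
    fun {ι} _ w hw g D₀ hrel S σf hcorner A A' hA M hM a ha H hH hM1 hMH => ?_⟩
  have hτ := hb w hw g D₀ hrel S σf hcorner A A' hA hM a ha
  set τ : ℝ := ‖fun i j => mixedEmbedding L (S i j)‖ with hτdef
  set sa : ℝ := ∑ σ, (w σ) σf * a σ ^ 2 with hsa
  have hM0 : 0 < M := lt_of_lt_of_le one_pos hM1
  have hM2 : M ^ 2 ≤ CB ^ 2 * H ^ 2 := by
    rw [← mul_pow]; exact pow_le_pow_left₀ hM0.le hMH 2
  have hsa0 : 0 ≤ sa := Finset.sum_nonneg fun σ _ => mul_nonneg (apply_nonneg _ σf) (sq_nonneg _)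
  have h1 : τ ≤ CT * (n * (CB ^ 2 * H ^ 2)) * sa :=
    hτ.trans (mul_le_mul_of_nonneg_right (mul_le_mul_of_nonneg_left (mul_le_mul_of_nonneg_left hM2 hn.le) hCT.le) hsa0)
  have hH2 : H ^ (-(2 : ℝ)) = (H ^ 2)⁻¹ := by
    rw [Real.rpow_neg hH.le, Real.rpow_two]
  have hkey : Real.pi / (CT * n * CB ^ 2) * H ^ (-(2 : ℝ)) * τ ≤ Real.pi * sa := by
    rw [hH2]
    have hpos : 0 < CT * n * CB ^ 2 * H ^ 2 := by positivity
    calc Real.pi / (CT * n * CB ^ 2) * (H ^ 2)⁻¹ * τ = Real.pi * τ / (CT * n * CB ^ 2 * H ^ 2) := by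
          field_simp
      _ ≤ Real.pi * (CT * (n * (CB ^ 2 * H ^ 2)) * sa) / (CT * n * CB ^ 2 * H ^ 2) :=
          div_le_div_of_nonneg_right (mul_le_mul_of_nonneg_left h1 Real.pi_pos.le) hpos.le
      _ = Real.pi * sa := by field_simp
  exact Real.exp_le_exp.2 (neg_le_neg hkey)

/-! ## §5 Edition 3 (append-only): the exponential face at a PAYER-CHOSEN Gaussian rate (repair (R2) of the one-frame assembly's block letter) -/

/-- **THE EXPONENTIAL FACE AT A GENERAL RATE, COVER-INDEXED**: for every rate `cπ > 0` (payer-chosen, as in KW's `hBL`) `∃ c > 0` (hermitian data, `C_B`, `cπ`) such that for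
the cover-indexed letters with `1 ≤ M ≤ C_B · H`: `exp(−cπ · Σ_σ (w σ)(σ♭) · (a σ)²) ≤ exp(−(c · H^{−2} · ‖fun i j => mixedEmbedding L (S i j)‖))`, `c = cπ ∕ (C_T · n · C_B²)`.
[cite: MoeglinWaldspurger1995, II.1.5, II.1.7] [cite: BorelJacquet1979, §1.2, §4.1] [cite: Shimura1997, §18.4 Prop. 18.14, §A3] -/
theorem exists_exp_neg_sum_le_exp_neg_height_of_cover_rate (hdV0 : ∀ i, dV i ≠ 0) (hdW0 : ∀ i, dW i ≠ 0) (i₀ : Fin n) [NeZero n]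
    {CB : ℝ} (hCB : 0 < CB) {cπ : ℝ} (hcπ : 0 < cπ) :
    ∃ c : ℝ, 0 < c ∧ ∀ {ι : Type*} [Fintype ι] (w : ι → InfinitePlace L), Function.Surjective w →
      ∀ (g : GL (Fin n) L) (D₀ : Matrix (Fin n) (Fin n) L),
      ((g : Matrix (Fin n) (Fin n) L).map ((IsCMField.complexConj L : L ≃ₐ[Fp L] L) : L →+* L))ᵀ * (gramR L e dV hdV dW hdW).map (algebraMap (Fp L) L) * D₀ =
          (gramR L e dV hdV dW hdW).map (algebraMap (Fp L) L) →
      ∀ (S : Matrix (Fin n) (Fin n) L) (σf : L), D₀ * S * (g : Matrix (Fin n) (Fin n) L)⁻¹ = Matrix.single i₀ i₀ σf →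
      ∀ (A A' : ι → Matrix (Fin n) (Fin n) ℂ), (∀ σ, A σ * A' σ = 1) → ∀ {M : ℝ}, (∀ σ k l, ‖A' σ k l‖ ≤ M) →
      ∀ (a : ι → ℝ), (∀ σ, ∑ k, ‖((fun l => ((w σ).embedding) ((g : Matrix (Fin n) (Fin n) L) i₀ l)) ᵥ* A σ) k‖ ^ 2 ≤ a σ ^ 2) →
      ∀ {H : ℝ}, 0 < H → 1 ≤ M → M ≤ CB * H →
      Real.exp (-(cπ * ∑ σ, (w σ) σf * a σ ^ 2)) ≤
        Real.exp (-(c * H ^ (-(2 : ℝ)) * ‖fun i j => mixedEmbedding L (S i j)‖)) := by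
  obtain ⟨CT, hCT, hb⟩ := exists_norm_mixedEmbedding_le_sum_of_cover L e dV hdV dW hdW hdV0 hdW0 i₀
  have hn : 0 < (n : ℝ) := Nat.cast_pos.2 (Nat.pos_of_ne_zero (NeZero.ne n))
  refine ⟨cπ / (CT * n * CB ^ 2), div_pos hcπ (mul_pos (mul_pos hCT hn) (pow_pos hCB 2)),
    fun {ι} _ w hw g D₀ hrel S σf hcorner A A' hA M hM a ha H hH hM1 hMH => ?_⟩
  have hτ := hb w hw g D₀ hrel S σf hcorner A A' hA hM a ha
  set τ : ℝ := ‖fun i j => mixedEmbedding L (S i j)‖ with hτdef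
  set sa : ℝ := ∑ σ, (w σ) σf * a σ ^ 2 with hsa
  have hM0 : 0 < M := lt_of_lt_of_le one_pos hM1
  have hM2 : M ^ 2 ≤ CB ^ 2 * H ^ 2 := by
    rw [← mul_pow]; exact pow_le_pow_left₀ hM0.le hMH 2
  have hsa0 : 0 ≤ sa := Finset.sum_nonneg fun σ _ => mul_nonneg (apply_nonneg _ σf) (sq_nonneg _)
  have h1 : τ ≤ CT * (n * (CB ^ 2 * H ^ 2)) * sa :=
    hτ.trans (mul_le_mul_of_nonneg_right (mul_le_mul_of_nonneg_left (mul_le_mul_of_nonneg_left hM2 hn.le) hCT.le) hsa0)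
  have hH2 : H ^ (-(2 : ℝ)) = (H ^ 2)⁻¹ := by
    rw [Real.rpow_neg hH.le, Real.rpow_two]
  have hkey : cπ / (CT * n * CB ^ 2) * H ^ (-(2 : ℝ)) * τ ≤ cπ * sa := by
    rw [hH2]
    have hpos : 0 < CT * n * CB ^ 2 * H ^ 2 := by positivity
    calc cπ / (CT * n * CB ^ 2) * (H ^ 2)⁻¹ * τ = cπ * τ / (CT * n * CB ^ 2 * H ^ 2) := by
          field_simp
      _ ≤ cπ * (CT * (n * (CB ^ 2 * H ^ 2)) * sa) / (CT * n * CB ^ 2 * H ^ 2) :=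
          div_le_div_of_nonneg_right (mul_le_mul_of_nonneg_left h1 hcπ.le) hpos.le
      _ = cπ * sa := by field_simp
  exact Real.exp_le_exp.2 (neg_le_neg hkey)

end Summit.HodgeConjecture.HodgeConjecture.Cruxes.HLiu418.K2LiuKindOneLineCornerGramBoundAdelic

end
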